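import Summits.Parity.BatemanHorn.Theorems.RoughValueTransportBalancedSemiprimeLayerOfRootLevel
import Summits.Parity.BatemanHorn.Theorems.RoughValueTransportBalancedSemiprimeLayerRelativeSieveStep
import Summits.Parity.BatemanHorn.Theorems.RoughValueTransportBalancedSemiprimeLayerRelativeTransfer
import Summits.Parity.BatemanHorn.Theorems.RoughValueTransportBalancedSemiprimeLayerRelativeLever
import HarnessLib

/-!
# Route `RoughValueTransport`, crux `BalancedSemiprimeLayer` (stmt-Parity-9469), line
# `Ideator4Sketch` = card `relative-mass-split`: the crux from the two atoms H1 ∧ H2 (stub S6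
# `stub_higherLayerOfSplit` + `balancedSemiprimeLayer_of_relativeSplit`), and the split is a weakening
# of the old residual S8 (`SplitOfAbsolute`)

The line books the `k`-dimensional sieve of the landed lever against the ACTUAL window-incidence mass.
Its three working stubs have landed — S1 `stub_relativeSiftedLe` (p127967), S2 `stub_relativeTransfer`
(p128158), S3 `stub_relativeLeverOfStep` (p127985) — and this file composes them with the landed
`stub_transfer` (p78616, degrees `≤ 2` and the glue `Φ_f ≤ P_f + Σᵢ Eᵢ`):

* `coordLayerThin_of_windowMass_of_relativeRootLevel` — the card's `RelativeLever`: for every coordinate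
  of degree `≥ 2` of every Bateman–Horn system, H1 (window mass `O(δx)`) and H2 (relative root level) for
  `g = fᵢ` make the coordinate layer thin;
* `stub_higherLayerOfSplit` (registered stub S6 of the skeleton `Cruxes/BalancedSemiprimeLayer/Lines/Ideator4Sketch.lean`)
  — H1 ∧ H2 for every irreducible `g` of degree `≥ 3` with positive leading coefficient ⟹ `CoordLayerThin`
  for every coordinate of degree `≥ 3` (the route's `LayerHigher`), and `balancedSemiprimeLayer_of_relativeSplit`
  — the card's `CruxOfSplit`: the same two hypotheses ⟹ `BalancedSemiprimeLayer` (`stub_transfer`).  The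
  hypotheses are DISPLAYED (not named) so that the planner can file them verbatim as statement items; the
  crux then closes `--by` the one-liner `balancedSemiprimeLayer_of_relativeSplit H1 H2`;
* `relativeRootLevel_of_absoluteRootLevel` — half of the card's `SplitOfAbsolute`, for EVERY `g`: the
  absolute root level S8 (`stub_roughWindowRootLevel_highDegree`'s body) implies H2 (triangle inequality:
  the `e = 1` defect `R₁ = Σ_m (B(m) − x·ρ(m)/m)` is dominated by EVERY row of S8, because the classes
  mod `e` partition `(0, x]`);
* `windowMass_of_absoluteRootLevel` — the other half, for `g` a one-member Bateman–Horn system: S8 ⟹ H1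
  (the `e = 1`, `s = 0` entry of S8 plus the landed anchors A `stub_rhoPrimeWindowSum` (p98740) and B
  `stub_roughWindowRhoSum` (p102251): `x·Σ_{m ∈ RW} ρ(m)/m ≤ (d²/c² + 1)·δ·x`).

So the crux is now kernel-reduced to H1 ∧ H2 (degree `≥ 3`), a residual implied by — and free of the
power-saving rough-window divisor ASYMPTOTIC contained in — S8.  Both atoms are OPEN (dead zone
`(1 + c_LPF, d − 1 − c_LPF)` of the large-prime mass profile; no supplier in the tree or in print).
References: the card `Cruxes/BalancedSemiprimeLayer/Ideas/relative-mass-split.md`; C. Hooley, Acta Math.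
117 (1967) 281–299 (divisor-switched sieve); everything used below is PROVED in the tree.
-/

noncomputable section

open Polynomial Filter Finset
open Literature.NumberTheory.Sieve
open scoped BigOperators

namespace Summit.Parity.BatemanHorn.Cruxes.BalancedSemiprimeLayer.RelativeMassSplit

open Summit.Parity.BatemanHorn.Theses.RoughValueTransport (BalancedSemiprimeLayer)
open Summit.Parity.BatemanHorn.Cruxes.BalancedSemiprimeLayer.RoughRelaxedDivisorSieve
  (roughDivWindow divWindow posRange windowPairCount stub_rhoPrimeWindowSum stub_roughWindowRhoSum)
open Summit.Parity.BatemanHorn.Cruxes.BalancedSemiprimeLayer.SmoothModulusTwistedHooley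
  (coordLayer CoordLayerThin stub_transfer)

/-! ### The relative lever (card: `RelativeLever`) -/

/-- **The relative lever, realised.**  For every Bateman–Horn system `f` and every coordinate `i` of
degree `≥ 2`: H1 (window mass `Σ_{m ∈ RW} #{n ≤ x : m ∣ fᵢ(n)} ≤ C·δ·x`) and H2 (relative root level)
for `g = fᵢ` imply `CoordLayerThin f i` — S3 at S1, fed with S2. [folklore] -/
theorem coordLayerThin_of_windowMass_of_relativeRootLevel {k : ℕ} {f : Fin k → ℤ[X]}
    (hf : IsBatemanHornSystem f) (i : Fin k) (hdeg : 2 ≤ (f i).natDegree)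
    (h1 : ∃ c₀ : ℝ, 0 < c₀ ∧ ∀ c : ℝ, 0 < c → c ≤ c₀ → ∃ C : ℝ, ∀ δ : ℝ, 0 < δ → δ ≤ c →
        ∀ᶠ x : ℕ in atTop,
          (∑ m ∈ roughDivWindow (f i).natDegree δ c x,
            (#((Ioc 0 x).filter fun n : ℕ => (m : ℤ) ∣ (f i).eval (n : ℤ)) : ℝ)) ≤ C * δ * x)
    (h2 : ∃ c₀ : ℝ, 0 < c₀ ∧ ∀ c : ℝ, 0 < c → c ≤ c₀ → ∀ δ : ℝ, 0 < δ → δ ≤ c →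
        ∃ η : ℝ, 0 < η ∧ ∀ᶠ x : ℕ in atTop,
          (∑ e ∈ (Icc 1 ⌊(x : ℝ) ^ c⌋₊).filter Squarefree, ∑ s ∈ range e,
            |∑ m ∈ roughDivWindow (f i).natDegree δ c x,
              ((#((Ioc 0 x).filter fun n : ℕ => n ≡ s [MOD e] ∧ (m : ℤ) ∣ (f i).eval (n : ℤ)) : ℝ) -
                (#((Ioc 0 x).filter fun n : ℕ => (m : ℤ) ∣ (f i).eval (n : ℤ)) : ℝ) / e)|) ≤
            (x : ℝ) ^ (1 - η)) :
    CoordLayerThin f i :=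
  stub_relativeLeverOfStep stub_relativeSiftedLe k f hf i (stub_relativeTransfer k f hf i hdeg h1 h2)

/-! ### S6 — the higher layer from the split; the crux from the split (card: `CruxOfSplit`) -/

/-- **S6 `stub_higherLayerOfSplit`** (registered stub of the skeleton
`Cruxes/BalancedSemiprimeLayer/Lines/Ideator4Sketch.lean`).  If every irreducible `g` of degree `≥ 3` with
positive leading coefficient satisfies H1 (first displayed hypothesis: window mass `O(δx)`, `δ`-free
constant) and H2 (second: relative root level, power saving), then every coordinate of degree `≥ 3` of
every Bateman–Horn system has a thin layer (`CoordLayerThin f i`, the route's `LayerHigher`):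
`coordLayerThin_of_windowMass_of_relativeRootLevel` at `g = fᵢ`. [folklore] -/
theorem stub_higherLayerOfSplit :
    (∀ g : ℤ[X], Irreducible g → 0 < g.leadingCoeff → 3 ≤ g.natDegree →
      ∃ c₀ : ℝ, 0 < c₀ ∧ ∀ c : ℝ, 0 < c → c ≤ c₀ → ∃ C : ℝ, ∀ δ : ℝ, 0 < δ → δ ≤ c →
        ∀ᶠ x : ℕ in atTop,
          (∑ m ∈ roughDivWindow g.natDegree δ c x,
            (#((Ioc 0 x).filter fun n : ℕ => (m : ℤ) ∣ g.eval (n : ℤ)) : ℝ)) ≤ C * δ * x) →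
    (∀ g : ℤ[X], Irreducible g → 0 < g.leadingCoeff → 3 ≤ g.natDegree →
      ∃ c₀ : ℝ, 0 < c₀ ∧ ∀ c : ℝ, 0 < c → c ≤ c₀ → ∀ δ : ℝ, 0 < δ → δ ≤ c →
        ∃ η : ℝ, 0 < η ∧ ∀ᶠ x : ℕ in atTop,
          (∑ e ∈ (Icc 1 ⌊(x : ℝ) ^ c⌋₊).filter Squarefree, ∑ s ∈ range e,
            |∑ m ∈ roughDivWindow g.natDegree δ c x,
              ((#((Ioc 0 x).filter fun n : ℕ => n ≡ s [MOD e] ∧ (m : ℤ) ∣ g.eval (n : ℤ)) : ℝ) -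
                (#((Ioc 0 x).filter fun n : ℕ => (m : ℤ) ∣ g.eval (n : ℤ)) : ℝ) / e)|) ≤
            (x : ℝ) ^ (1 - η)) →
    ∀ (k : ℕ) (f : Fin k → ℤ[X]), IsBatemanHornSystem f →
      ∀ i : Fin k, 3 ≤ (f i).natDegree → CoordLayerThin f i :=
  fun h1 h2 _k f hf i hi =>
    coordLayerThin_of_windowMass_of_relativeRootLevel hf i ((Nat.le_succ 2).trans hi)
      (h1 (f i) (hf.irreducible i) (hf.leadingCoeff_pos i) hi)
      (h2 (f i) (hf.irreducible i) (hf.leadingCoeff_pos i) hi)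

/-- **The crux from the split — the card's `CruxOfSplit`, realised.**  If every irreducible `g` of degree
`≥ 3` with positive leading coefficient satisfies H1 and H2 (displayed, not named, so that the planner can
file them verbatim as statement items), then `BalancedSemiprimeLayer`: `stub_transfer` (p78616) at
`stub_higherLayerOfSplit`.  The crux closes `--by` the one-liner `balancedSemiprimeLayer_of_relativeSplit H1 H2`
the moment both are theorems. [folklore] -/
theorem balancedSemiprimeLayer_of_relativeSplit
    (h1 : ∀ g : ℤ[X], Irreducible g → 0 < g.leadingCoeff → 3 ≤ g.natDegree →
      ∃ c₀ : ℝ, 0 < c₀ ∧ ∀ c : ℝ, 0 < c → c ≤ c₀ → ∃ C : ℝ, ∀ δ : ℝ, 0 < δ → δ ≤ c →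
        ∀ᶠ x : ℕ in atTop,
          (∑ m ∈ roughDivWindow g.natDegree δ c x,
            (#((Ioc 0 x).filter fun n : ℕ => (m : ℤ) ∣ g.eval (n : ℤ)) : ℝ)) ≤ C * δ * x)
    (h2 : ∀ g : ℤ[X], Irreducible g → 0 < g.leadingCoeff → 3 ≤ g.natDegree →
      ∃ c₀ : ℝ, 0 < c₀ ∧ ∀ c : ℝ, 0 < c → c ≤ c₀ → ∀ δ : ℝ, 0 < δ → δ ≤ c →
        ∃ η : ℝ, 0 < η ∧ ∀ᶠ x : ℕ in atTop,
          (∑ e ∈ (Icc 1 ⌊(x : ℝ) ^ c⌋₊).filter Squarefree, ∑ s ∈ range e,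
            |∑ m ∈ roughDivWindow g.natDegree δ c x,
              ((#((Ioc 0 x).filter fun n : ℕ => n ≡ s [MOD e] ∧ (m : ℤ) ∣ g.eval (n : ℤ)) : ℝ) -
                (#((Ioc 0 x).filter fun n : ℕ => (m : ℤ) ∣ g.eval (n : ℤ)) : ℝ) / e)|) ≤
            (x : ℝ) ^ (1 - η)) :
    BalancedSemiprimeLayer :=
  stub_transfer (stub_higherLayerOfSplit h1 h2)

/-! ### The split is a weakening of S8 (card: `SplitOfAbsolute`) -/

/-- The classes mod `e ≥ 1` partition a count: `#{n ∈ S : P n} = Σ_{s < e} #{n ∈ S : n ≡ s (e) ∧ P n}`.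
[folklore] -/
theorem card_filter_eq_sum_range_modEq (S : Finset ℕ) (P : ℕ → Prop) [DecidablePred P] {e : ℕ}
    (he : 0 < e) :
    #(S.filter P) = ∑ s ∈ range e, #(S.filter fun n : ℕ => n ≡ s [MOD e] ∧ P n) := by
  rw [Finset.card_eq_sum_card_fiberwise (f := fun n : ℕ => n % e) (t := range e)
    (fun n _ => by simpa using Nat.mod_lt n he)]
  refine Finset.sum_congr rfl fun s hs => ?_
  rw [mem_range] at hs
  congr 1
  ext n
  simp only [mem_filter, Nat.ModEq, Nat.mod_eq_of_lt hs]
  tauto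

/-- **`SplitOfAbsolute`, H2 half — for EVERY `g`.**  The absolute root level (the body of S8
`stub_roughWindowRootLevel_highDegree`, for one `g`) implies the relative root level H2, with saving
`η/2`: for each `e`, `Σ_s |Σ_m (A(m,e,s) − B(m)/e)| ≤ Σ_s |Σ_m (A(m,e,s) − (x/e)ρ(m)/m)| + |R₁|` with
`R₁ = Σ_m (B(m) − x·ρ(m)/m) = Σ_s Σ_m (A(m,e,s) − (x/e)ρ(m)/m)` (the classes mod `e` partition `(0,x]`),
so every row of H2 is at most twice the corresponding row of S8. [folklore] -/
theorem relativeRootLevel_of_absoluteRootLevel (g : ℤ[X])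
    (h8 : ∃ c₀ : ℝ, 0 < c₀ ∧ ∀ c : ℝ, 0 < c → c ≤ c₀ → ∀ δ : ℝ, 0 < δ → δ ≤ c →
      ∃ η : ℝ, 0 < η ∧ ∀ᶠ x : ℕ in atTop,
        (∑ e ∈ (Icc 1 ⌊(x : ℝ) ^ c⌋₊).filter Squarefree, ∑ s ∈ range e,
          |∑ m ∈ roughDivWindow g.natDegree δ c x,
            ((#((Ioc 0 x).filter fun n : ℕ => n ≡ s [MOD e] ∧ (m : ℤ) ∣ g.eval (n : ℤ)) : ℝ) -
              (x : ℝ) / e * ((polyRootCountMod ![g] m : ℝ) / m))|) ≤ (x : ℝ) ^ (1 - η)) :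
    ∃ c₀ : ℝ, 0 < c₀ ∧ ∀ c : ℝ, 0 < c → c ≤ c₀ → ∀ δ : ℝ, 0 < δ → δ ≤ c →
      ∃ η : ℝ, 0 < η ∧ ∀ᶠ x : ℕ in atTop,
        (∑ e ∈ (Icc 1 ⌊(x : ℝ) ^ c⌋₊).filter Squarefree, ∑ s ∈ range e,
          |∑ m ∈ roughDivWindow g.natDegree δ c x,
            ((#((Ioc 0 x).filter fun n : ℕ => n ≡ s [MOD e] ∧ (m : ℤ) ∣ g.eval (n : ℤ)) : ℝ) -
              (#((Ioc 0 x).filter fun n : ℕ => (m : ℤ) ∣ g.eval (n : ℤ)) : ℝ) / e)|) ≤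
          (x : ℝ) ^ (1 - η) := by
  obtain ⟨c₀, hc₀, H⟩ := h8
  refine ⟨c₀, hc₀, fun c hc hcc δ hδ hδc => ?_⟩
  obtain ⟨η, hη, hev⟩ := H c hc hcc δ hδ hδc
  refine ⟨η / 2, half_pos hη, ?_⟩
  have h2 : ∀ᶠ x : ℕ in atTop, (2 : ℝ) ≤ (x : ℝ) ^ (η / 2) :=
    ((tendsto_rpow_atTop (half_pos hη)).comp tendsto_natCast_atTop_atTop).eventually_ge_atTop _
  filter_upwards [hev, h2, eventually_ge_atTop 1] with x hx hx2 hx1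
  have hX : (0 : ℝ) < x := by exact_mod_cast hx1
  -- abbreviations
  set M := roughDivWindow g.natDegree δ c x with hM
  set A : ℕ → ℕ → ℕ → ℝ := fun m e s =>
    (#((Ioc 0 x).filter fun n : ℕ => n ≡ s [MOD e] ∧ (m : ℤ) ∣ g.eval (n : ℤ)) : ℝ) with hA
  set B : ℕ → ℝ := fun m => (#((Ioc 0 x).filter fun n : ℕ => (m : ℤ) ∣ g.eval (n : ℤ)) : ℝ) with hB
  set ρ : ℕ → ℝ := fun m => (polyRootCountMod ![g] m : ℝ) / m with hρ
  -- per-row comparison: H2-row(e) ≤ 2 · S8-row(e) for `e ≥ 1`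
  have hrow : ∀ e : ℕ, 0 < e →
      (∑ s ∈ range e, |∑ m ∈ M, (A m e s - B m / e)|) ≤
        2 * ∑ s ∈ range e, |∑ m ∈ M, (A m e s - (x : ℝ) / e * ρ m)| := by
    intro e he
    have he' : (e : ℝ) ≠ 0 := by exact_mod_cast he.ne'
    -- the `e = 1` defect and its domination by the row
    set R₁ : ℝ := ∑ m ∈ M, (B m - (x : ℝ) * ρ m) with hR₁
    have hpart : ∀ m : ℕ, ∑ s ∈ range e, A m e s = B m := by
      intro m
      rw [hA, hB]
      simp only
      rw [card_filter_eq_sum_range_modEq (Ioc 0 x) (fun n : ℕ => (m : ℤ) ∣ g.eval (n : ℤ)) he]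
      push_cast
      rfl
    have hR₁eq : R₁ = ∑ s ∈ range e, ∑ m ∈ M, (A m e s - (x : ℝ) / e * ρ m) := by
      rw [Finset.sum_comm]
      refine Finset.sum_congr rfl fun m _ => ?_
      rw [Finset.sum_sub_distrib, hpart m, Finset.sum_const, card_range, nsmul_eq_mul]
      field_simp
    have hR₁le : |R₁| ≤ ∑ s ∈ range e, |∑ m ∈ M, (A m e s - (x : ℝ) / e * ρ m)| := by
      rw [hR₁eq]
      exact Finset.abs_sum_le_sum_abs _ _
    -- termwise triangle inequality
    have hterm : ∀ s : ℕ, |∑ m ∈ M, (A m e s - B m / e)| ≤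
        |∑ m ∈ M, (A m e s - (x : ℝ) / e * ρ m)| + |R₁| / e := by
      intro s
      have hsplit : ∑ m ∈ M, (A m e s - B m / e) =
          ∑ m ∈ M, (A m e s - (x : ℝ) / e * ρ m) - R₁ / e := by
        rw [hR₁, Finset.sum_div, ← Finset.sum_sub_distrib]
        refine Finset.sum_congr rfl fun m _ => ?_
        field_simp
        ring
      rw [hsplit]
      refine (abs_sub _ _).trans ?_
      rw [abs_div, Nat.abs_cast]
    calc (∑ s ∈ range e, |∑ m ∈ M, (A m e s - B m / e)|)
        ≤ ∑ s ∈ range e, (|∑ m ∈ M, (A m e s - (x : ℝ) / e * ρ m)| + |R₁| / e) :=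
          Finset.sum_le_sum fun s _ => hterm s
      _ = (∑ s ∈ range e, |∑ m ∈ M, (A m e s - (x : ℝ) / e * ρ m)|) + |R₁| := by
          rw [Finset.sum_add_distrib, Finset.sum_const, card_range, nsmul_eq_mul,
            mul_div_cancel₀ _ he']
      _ ≤ _ := by linarith [hR₁le]
  -- sum over the sieve moduli
  have hE : ∀ e ∈ (Icc 1 ⌊(x : ℝ) ^ c⌋₊).filter Squarefree, 0 < e := fun e he => by
    rw [mem_filter, mem_Icc] at he
    exact he.1.1
  calc (∑ e ∈ (Icc 1 ⌊(x : ℝ) ^ c⌋₊).filter Squarefree, ∑ s ∈ range e,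
        |∑ m ∈ M, (A m e s - B m / e)|)
      ≤ ∑ e ∈ (Icc 1 ⌊(x : ℝ) ^ c⌋₊).filter Squarefree,
          2 * ∑ s ∈ range e, |∑ m ∈ M, (A m e s - (x : ℝ) / e * ρ m)| :=
        Finset.sum_le_sum fun e he => hrow e (hE e he)
    _ = 2 * ∑ e ∈ (Icc 1 ⌊(x : ℝ) ^ c⌋₊).filter Squarefree,
          ∑ s ∈ range e, |∑ m ∈ M, (A m e s - (x : ℝ) / e * ρ m)| := by rw [Finset.mul_sum]
    _ ≤ 2 * (x : ℝ) ^ (1 - η) := by linarith [hx]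
    _ ≤ (x : ℝ) ^ (η / 2) * (x : ℝ) ^ (1 - η) :=
        mul_le_mul_of_nonneg_right hx2 (Real.rpow_nonneg hX.le _)
    _ = (x : ℝ) ^ (1 - η / 2) := by
        rw [← Real.rpow_add hX]
        ring_nf

/-- **`SplitOfAbsolute`, H1 half — for `g` a one-member Bateman–Horn system.**  The absolute root
level S8 for `g` implies the window mass H1 with `C = d²/c² + 2` on `c ≤ min(c₀, 1/2)`: the `e = 1`,
`s = 0` entry of S8 gives `Σ_m B(m) ≤ x·Σ_{m ∈ RW} ρ(m)/m + x^{1−η}`, anchor B (`stub_roughWindowRhoSum`,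
fed by anchor A `stub_rhoPrimeWindowSum` — Mertens for `ρ_g`, which is where the Bateman–Horn
hypothesis on `![g]` enters) gives `Σ_{m ∈ RW} ρ(m)/m ≤ (d²/c² + 1)·δ`, and `x^{1−η} ≤ δ·x` eventually.
[folklore] -/
theorem windowMass_of_absoluteRootLevel (g : ℤ[X]) (hg : IsBatemanHornSystem ![g])
    (h8 : ∃ c₀ : ℝ, 0 < c₀ ∧ ∀ c : ℝ, 0 < c → c ≤ c₀ → ∀ δ : ℝ, 0 < δ → δ ≤ c →
      ∃ η : ℝ, 0 < η ∧ ∀ᶠ x : ℕ in atTop,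
        (∑ e ∈ (Icc 1 ⌊(x : ℝ) ^ c⌋₊).filter Squarefree, ∑ s ∈ range e,
          |∑ m ∈ roughDivWindow g.natDegree δ c x,
            ((#((Ioc 0 x).filter fun n : ℕ => n ≡ s [MOD e] ∧ (m : ℤ) ∣ g.eval (n : ℤ)) : ℝ) -
              (x : ℝ) / e * ((polyRootCountMod ![g] m : ℝ) / m))|) ≤ (x : ℝ) ^ (1 - η)) :
    ∃ c₀ : ℝ, 0 < c₀ ∧ ∀ c : ℝ, 0 < c → c ≤ c₀ → ∃ C : ℝ, ∀ δ : ℝ, 0 < δ → δ ≤ c →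
      ∀ᶠ x : ℕ in atTop,
        (∑ m ∈ roughDivWindow g.natDegree δ c x,
          (#((Ioc 0 x).filter fun n : ℕ => (m : ℤ) ∣ g.eval (n : ℤ)) : ℝ)) ≤ C * δ * x := by
  obtain ⟨c₀, hc₀, H⟩ := h8
  -- Mertens data of `g` (anchor A) and the degree
  have hd1 : 1 ≤ g.natDegree := by
    have h := Summit.Parity.BatemanHorn.Theorems.BalancedSemiprimeLayer.Negative.natDegree_pos_of_isBatemanHornSystem hg 0
    simp only [Matrix.cons_val_fin_one] at h
    omega
  obtain ⟨Cg, hCg0, hCg⟩ := exists_hasBatemanHornConst_holds (ι := Fin 1) hg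
  have hρlt : ∀ p : ℕ, p.Prime → polyRootCountMod ![g] p < p := fun p hp =>
    hg.hasNoFixedPrimeDivisor p hp
  have hW := stub_rhoPrimeWindowSum g Cg hCg0 hCg hρlt
  refine ⟨min c₀ (1 / 2), lt_min hc₀ one_half_pos, fun c hc hcc => ?_⟩
  have hcc₀ : c ≤ c₀ := hcc.trans (min_le_left _ _)
  have hc2 : c ≤ 1 / 2 := hcc.trans (min_le_right _ _)
  have hc1 : c ≤ 1 := by linarith
  refine ⟨(g.natDegree : ℝ) ^ 2 / c ^ 2 + 2, fun δ hδ hδc => ?_⟩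
  have hδ2 : δ ≤ 1 / 2 := by linarith
  obtain ⟨η, hη, hev⟩ := H c hc hcc₀ δ hδ hδc
  have hBx := stub_roughWindowRhoSum g hW g.natDegree c δ δ hd1 hc hc1 hδ hδ2 hδ
  -- `x^{1-η} ≤ δ·x` eventually
  have hsmall : ∀ᶠ x : ℕ in atTop, (x : ℝ) ^ (1 - η) ≤ δ * x := by
    have h1 : ∀ᶠ x : ℝ in atTop, x ^ (-η) ≤ δ :=
      (tendsto_rpow_neg_atTop hη).eventually (ge_mem_nhds hδ)
    filter_upwards [tendsto_natCast_atTop_atTop.eventually h1, eventually_ge_atTop 1] with x hx hx1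
    have hX : (0 : ℝ) < x := by exact_mod_cast hx1
    calc (x : ℝ) ^ (1 - η) = (x : ℝ) ^ (-η) * x := by
          rw [show (1 - η) = -η + 1 by ring, Real.rpow_add hX, Real.rpow_one]
      _ ≤ δ * x := mul_le_mul_of_nonneg_right hx hX.le
  have hxc : ∀ᶠ x : ℕ in atTop, (1 : ℝ) ≤ (x : ℝ) ^ c :=
    ((tendsto_rpow_atTop hc).comp tendsto_natCast_atTop_atTop).eventually_ge_atTop _
  filter_upwards [hev, hBx, hsmall, hxc, eventually_ge_atTop 1] with x hx hBx hsmall hxc hx1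
  have hX : (0 : ℝ) < x := by exact_mod_cast hx1
  set M := roughDivWindow g.natDegree δ c x with hM
  -- the `e = 1`, `s = 0` entry of S8
  have h1mem : (1 : ℕ) ∈ (Icc 1 ⌊(x : ℝ) ^ c⌋₊).filter Squarefree := by
    rw [mem_filter, mem_Icc]
    exact ⟨⟨le_rfl, Nat.le_floor (by simpa using hxc)⟩, squarefree_one⟩
  have hrow1 : |∑ m ∈ M, ((#((Ioc 0 x).filter fun n : ℕ => (m : ℤ) ∣ g.eval (n : ℤ)) : ℝ) -
      (x : ℝ) * ((polyRootCountMod ![g] m : ℝ) / m))| ≤ (x : ℝ) ^ (1 - η) := by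
    have hle := Finset.single_le_sum (f := fun e : ℕ => ∑ s ∈ range e,
        |∑ m ∈ M, ((#((Ioc 0 x).filter fun n : ℕ => n ≡ s [MOD e] ∧ (m : ℤ) ∣ g.eval (n : ℤ)) : ℝ) -
          (x : ℝ) / e * ((polyRootCountMod ![g] m : ℝ) / m))|)
      (fun e _ => Finset.sum_nonneg fun s _ => abs_nonneg _) h1mem
    have h1row : (∑ s ∈ range 1,
        |∑ m ∈ M, ((#((Ioc 0 x).filter fun n : ℕ => n ≡ s [MOD 1] ∧ (m : ℤ) ∣ g.eval (n : ℤ)) : ℝ) -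
          (x : ℝ) / (1 : ℕ) * ((polyRootCountMod ![g] m : ℝ) / m))|) =
        |∑ m ∈ M, ((#((Ioc 0 x).filter fun n : ℕ => (m : ℤ) ∣ g.eval (n : ℤ)) : ℝ) -
          (x : ℝ) * ((polyRootCountMod ![g] m : ℝ) / m))| := by
      rw [Finset.range_one, Finset.sum_singleton, Nat.cast_one, div_one]
      congr 1
      refine Finset.sum_congr rfl fun m _ => ?_
      congr 3
      exact Finset.filter_congr fun n _ => by simp [Nat.modEq_one]
    rw [← h1row]
    exact hle.trans hx
  -- assemble
  have hsum : ∑ m ∈ M, ((#((Ioc 0 x).filter fun n : ℕ => (m : ℤ) ∣ g.eval (n : ℤ)) : ℝ)) =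
      (x : ℝ) * (∑ m ∈ M, (polyRootCountMod ![g] m : ℝ) / m) +
        ∑ m ∈ M, (((#((Ioc 0 x).filter fun n : ℕ => (m : ℤ) ∣ g.eval (n : ℤ)) : ℝ) -
          (x : ℝ) * ((polyRootCountMod ![g] m : ℝ) / m))) := by
    rw [Finset.mul_sum, ← Finset.sum_add_distrib]
    refine Finset.sum_congr rfl fun m _ => ?_
    ring
  have hab := (abs_le.mp hrow1).2
  calc ∑ m ∈ M, ((#((Ioc 0 x).filter fun n : ℕ => (m : ℤ) ∣ g.eval (n : ℤ)) : ℝ))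
      ≤ (x : ℝ) * ((g.natDegree : ℝ) ^ 2 * δ / c ^ 2 + δ) + (x : ℝ) ^ (1 - η) := by
        rw [hsum]
        exact add_le_add (mul_le_mul_of_nonneg_left hBx hX.le) hab
    _ ≤ (x : ℝ) * ((g.natDegree : ℝ) ^ 2 * δ / c ^ 2 + δ) + δ * x := by linarith [hsmall]
    _ = ((g.natDegree : ℝ) ^ 2 / c ^ 2 + 2) * δ * x := by ring

/-- **The crux from the old residual, through the split** (consistency check of the reduction: S8 for
one-member Bateman–Horn systems of degree `≥ 3` ⟹ crux, now factored through H1 ∧ H2 and the relative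
lever instead of `stub_rootLevelTransfer`/`stub_roughWindowLever`). [folklore] -/
theorem balancedSemiprimeLayer_of_absoluteRootLevel_via_split
    (h8 : ∀ g : ℤ[X], Irreducible g → 0 < g.leadingCoeff → 3 ≤ g.natDegree →
      ∃ c₀ : ℝ, 0 < c₀ ∧ ∀ c : ℝ, 0 < c → c ≤ c₀ → ∀ δ : ℝ, 0 < δ → δ ≤ c →
        ∃ η : ℝ, 0 < η ∧ ∀ᶠ x : ℕ in atTop,
          (∑ e ∈ (Icc 1 ⌊(x : ℝ) ^ c⌋₊).filter Squarefree, ∑ s ∈ range e,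
            |∑ m ∈ roughDivWindow g.natDegree δ c x,
              ((#((Ioc 0 x).filter fun n : ℕ => n ≡ s [MOD e] ∧ (m : ℤ) ∣ g.eval (n : ℤ)) : ℝ) -
                (x : ℝ) / e * ((polyRootCountMod ![g] m : ℝ) / m))|) ≤ (x : ℝ) ^ (1 - η)) :
    BalancedSemiprimeLayer :=
  stub_transfer fun _k f hf i hi =>
    coordLayerThin_of_windowMass_of_relativeRootLevel hf i ((Nat.le_succ 2).trans hi)
      (windowMass_of_absoluteRootLevel (f i) (BatemanHornMertens.isBatemanHornSystem_single hf i)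
        (h8 (f i) (hf.irreducible i) (hf.leadingCoeff_pos i) hi))
      (relativeRootLevel_of_absoluteRootLevel (f i)
        (h8 (f i) (hf.irreducible i) (hf.leadingCoeff_pos i) hi))

end Summit.Parity.BatemanHorn.Cruxes.BalancedSemiprimeLayer.RelativeMassSplit

end
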